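import Literature.RingTheory.TightClosure.TightClosure
import Literature.AlgebraicGeometry.Resolution.FFinite
import Mathlib.RingTheory.Flat.Basic
import Mathlib.RingTheory.RingHom.Flat
import Mathlib.RingTheory.Finiteness.Defs
import HarnessLib

/-!
# The Frobenius push-forward `F^e_* R` as an honest `R`-module

Topic: `Literature/RingTheory/TightClosure`. For a commutative ring `R` of exponential
characteristic `p`, the `e`-th Frobenius push-forward `F^e_* R` is the abelian group `R` with the
scalar action `r • x = r^(p^e) x` (restriction of scalars along the `e`-th iterate of the Frobenius
endomorphism); for reduced `R` it is the `R`-module `R^{1/q}`, `q = p^e`, of Hochster–Huneke and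
Kunz. An `R`-linear map `F^e_* R → R` is the same thing as an additive map `ψ : R → R` with
`ψ(a^q b) = a ψ(b)` ("`p^{-e}`-linear map"), the basic tool of the theory of test elements
(Hochster–Huneke 1989, §3; Huneke 1996, proof of Thm. 3.2: "an `R`-linear homomorphism from
`R^{1/p}` to `R` which sends `1` to `c`").

This file provides the type synonym `FrobeniusPushforward p e R` with its `CommRing` structure,
the tautological ring isomorphism `toPush : R ≃+* FrobeniusPushforward p e R`, and, for any
`R`-algebra `A → R`... more precisely for any `[Algebra A R]`, the algebra structure
`A → R —F^e→ R = F^e_* R` (so that `F^e_* R_P` is at the same time an `R_P`- and an `R`-module, in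
a scalar tower). PROVED here:

* `smul_def` — `a • x = toPush ((algebraMap A R a)^(p^e)) * x`;
* `finite_of_isFFinite` — `F^e_* R` is a finitely generated `R`-module when `R` is F-finite at
  level `e` (`Literature.AlgebraicGeometry.Resolution.IsFFinite p e R`, Kunz 1969);
* `flat_of_flat_iterateFrobenius` — `F^e_* R` is `R`-flat when the `e`-th iterate of the
  Frobenius is a flat ring map (e.g. `R` regular local: Kunz 1969, in tree);
* `apply_toPush_mem_of_mem_frobeniusPower` — an `R`-linear `ψ : F^e_* R → R` maps the Frobenius
  power `J^[p^e]` into `J`;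
* `IsFFinite.of_level_one` — F-finiteness at level `1` implies F-finiteness at every level.

What is NOT here: the identification with `R^{1/q}` for reduced `R`; Kunz's theorem itself
(`Literature/AlgebraicGeometry/Resolution/KunzRegularityCriterion*.lean`); test elements
(`TestElements.lean`, `TestElementsExist.lean`).

## Sources

* [HochsterHuneke1989] M. Hochster, C. Huneke, *Tight closure and strong F-regularity*, Mém. Soc.
  Math. France 38 (1989) 119–133, §3.
* [Huneke1998] C. Huneke, *Tight closure, parameter ideals, and geometry*, in: Six Lectures on
  Commutative Algebra, Progr. Math. 166 (1998), proof of Thm. 3.2.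
* [Kunz1969] E. Kunz, Amer. J. Math. 91 (1969) 772–784, §1–2.
-/

noncomputable section

namespace Literature.RingTheory.TightClosure

open Literature.AlgebraicGeometry.Resolution

universe u v w

/-! ## F-finiteness at all levels from level one -/

/-- **F-finite at level `1` ⇒ F-finite at level `e`**: if `A = ∑ᵢ A^p sᵢ` then
`A = ∑_{i,j} A^(p^(e+1)) (tⱼ^p ... )`; precisely, from `a = ∑ᵢ cᵢ^(p^e) tᵢ` and
`cᵢ = ∑ⱼ d_{ij}^p sⱼ` one gets `a = ∑_{i,j} d_{ij}^(p^(e+1)) (sⱼ^(p^e) tᵢ)` in characteristic `p`.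
A dot-notation extension of `Literature.AlgebraicGeometry.Resolution.IsFFinite` (declared in
`Literature/AlgebraicGeometry/Resolution/FFinite.lean`), stated with its absolute name.
[cite: Kunz1969, §1–2] -/
theorem _root_.Literature.AlgebraicGeometry.Resolution.IsFFinite.of_level_one {p : ℕ}
    {A : Type u} [CommRing A] [ExpChar A p] (h : IsFFinite p 1 A) (e : ℕ) : IsFFinite p e A := by
  classical
  induction e with
  | zero =>
    refine ⟨1, fun _ => 1, fun a => ⟨fun _ => a, ?_⟩⟩
    simp
  | succ e ih =>
    obtain ⟨n, t, ht⟩ := ih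
    obtain ⟨m, s, hs⟩ := h
    refine isFFinite_of_fintype (ι := Fin n × Fin m) (fun ij => s ij.2 ^ p ^ e * t ij.1) fun a => ?_
    obtain ⟨c, hc⟩ := ht a
    choose d hd using fun i => hs (c i)
    refine ⟨fun ij => d ij.1 ij.2, ?_⟩
    rw [hc, Fintype.sum_prod_type]
    refine Finset.sum_congr rfl fun i _ => ?_
    have hci : c i ^ p ^ e = ∑ j, d i j ^ p ^ (e + 1) * s j ^ p ^ e := by
      rw [hd i, sum_pow_char_pow]
      refine Finset.sum_congr rfl fun j _ => ?_
      rw [mul_pow, ← pow_mul, pow_one, ← pow_succ']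
    rw [hci, Finset.sum_mul]
    refine Finset.sum_congr rfl fun j _ => ?_
    ring

/-! ## The type synonym -/

/-- The `e`-th **Frobenius push-forward** `F^e_* R` of a commutative ring `R` (of exponential
characteristic `p`): the ring `R` itself, to be equipped with the twisted scalar action
`r • x = r^(p^e) x`. [cite: HochsterHuneke1989, §3 (the module `R^{1/q}`)] -/
@[nolint unusedArguments]
def FrobeniusPushforward (_p _e : ℕ) (R : Type u) [CommRing R] : Type u := R

namespace FrobeniusPushforward

variable {p e : ℕ} {R : Type u} [CommRing R]

/-- `F^e_* R` is the ring `R`. [folklore] -/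
instance instCommRing : CommRing (FrobeniusPushforward p e R) := inferInstanceAs (CommRing R)

/-- `F^e_* R` is inhabited (by `0`). [folklore] -/
instance instInhabited : Inhabited (FrobeniusPushforward p e R) := ⟨(0 : R)⟩

/-- The tautological ring isomorphism `R ≃ F^e_* R` (the identity on elements). [folklore] -/
def toPush : R ≃+* FrobeniusPushforward p e R := RingEquiv.refl R

/-- `toPush` is the identity on underlying elements. [folklore] -/
theorem toPush_symm_apply_eq (x : FrobeniusPushforward p e R) :
    ((toPush (p := p) (e := e) (R := R)).symm x : R) = (x : R) := rfl

/-- `F^e_* R` is nontrivial when `R` is. [folklore] -/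
instance instNontrivial [Nontrivial R] : Nontrivial (FrobeniusPushforward p e R) :=
  inferInstanceAs (Nontrivial R)

/-- `F^e_* R` is reduced when `R` is. [folklore] -/
instance instIsReduced [IsReduced R] : IsReduced (FrobeniusPushforward p e R) :=
  inferInstanceAs (IsReduced R)

variable [ExpChar R p]

/-- For an `A`-algebra `R` of exponential characteristic `p`, `F^e_* R` is an `A`-algebra through
`A → R —(x ↦ x^(p^e))→ R = F^e_* R`. For `A = R` this is the push-forward module structure
`r • x = r^(p^e) x`. [cite: HochsterHuneke1989, §3 (the module `R^{1/q}`)] -/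
instance instAlgebra {A : Type v} [CommRing A] [Algebra A R] :
    Algebra A (FrobeniusPushforward p e R) :=
  ((toPush (p := p) (e := e) (R := R)).toRingHom.comp
    ((iterateFrobenius R p e).comp (algebraMap A R))).toAlgebra

/-- The structure map `A → F^e_* R` is `a ↦ (algebraMap A R a)^(p^e)`. [folklore] -/
theorem algebraMap_apply {A : Type v} [CommRing A] [Algebra A R] (a : A) :
    algebraMap A (FrobeniusPushforward p e R) a = toPush ((algebraMap A R a) ^ p ^ e) := by
  show toPush (iterateFrobenius R p e (algebraMap A R a)) = _
  rw [iterateFrobenius_def]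

/-- The twisted scalar action: `a • x = (algebraMap A R a)^(p^e) · x`. [folklore] -/
theorem smul_def {A : Type v} [CommRing A] [Algebra A R] (a : A)
    (x : FrobeniusPushforward p e R) :
    a • x = toPush ((algebraMap A R a) ^ p ^ e) * x := by
  rw [Algebra.smul_def, algebraMap_apply]

/-- The push-forward module structure on `R` itself: `r • toPush x = toPush (r^(p^e) x)`.
[folklore] -/
theorem smul_toPush (r x : R) :
    r • (toPush x : FrobeniusPushforward p e R) = toPush (r ^ p ^ e * x) := by
  rw [smul_def, map_mul]
  rfl

/-- The algebra structures along a tower `A → B → R` form a scalar tower on `F^e_* R`.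
[folklore] -/
instance instIsScalarTower {A : Type v} {B : Type w} [CommRing A] [CommRing B] [Algebra A B]
    [Algebra B R] [Algebra A R] [IsScalarTower A B R] :
    IsScalarTower A B (FrobeniusPushforward p e R) :=
  IsScalarTower.of_algebraMap_eq fun a => by
    rw [algebraMap_apply, algebraMap_apply, IsScalarTower.algebraMap_apply A B R]

/-- `F^e_* R` over itself... rather: the `R`-algebra `F^e_* R` and the ring `F^e_* R` acting on
itself form a scalar tower (so that `R`-linear maps out of `F^e_* R` may be composed with left
multiplications). [folklore] -/
instance instIsScalarTowerSelf :
    IsScalarTower R (FrobeniusPushforward p e R) (FrobeniusPushforward p e R) :=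
  IsScalarTower.right

/-! ## Finiteness and flatness -/

/-- **`F^e_* R` is finitely generated when `R` is F-finite at level `e`**: if every `a ∈ R` is
`∑ᵢ cᵢ^(p^e) sᵢ`, the `sᵢ` generate `F^e_* R`. [cite: Kunz1969, §1–2] -/
theorem finite_of_isFFinite (h : IsFFinite p e R) : Module.Finite R (FrobeniusPushforward p e R) := by
  obtain ⟨n, s, hs⟩ := h
  refine Module.Finite.of_surjective
    (Fintype.linearCombination R (fun i => (toPush (s i) : FrobeniusPushforward p e R))) ?_
  intro x
  obtain ⟨c, hc⟩ := hs ((toPush (p := p) (e := e)).symm x)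
  refine ⟨c, ?_⟩
  rw [Fintype.linearCombination_apply]
  apply (toPush (p := p) (e := e) (R := R)).symm.injective
  rw [hc, map_sum]
  refine Finset.sum_congr rfl fun i _ => ?_
  rw [smul_toPush]
  rfl

/-- **`F^e_* R` is flat when the `e`-th iterate of the Frobenius is a flat ring map** (for a
regular local ring this is Kunz's theorem, `Kunz1969.flat_frobenius_of_isRegularLocalRing` and
`Kunz1969.flat_iterateFrobenius` in `Literature/AlgebraicGeometry/Resolution/`).
[cite: Kunz1969, Thm. 2.1] -/
theorem flat_of_flat_iterateFrobenius (h : (iterateFrobenius R p e).Flat) :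
    Module.Flat R (FrobeniusPushforward p e R) := by
  have h1 : ((iterateFrobenius R p e).comp (algebraMap R R)).Flat := RingHom.Flat.comp (.id R) h
  have h2 : ((toPush (p := p) (e := e) (R := R)).toRingHom.comp
      ((iterateFrobenius R p e).comp (algebraMap R R))).Flat :=
    RingHom.Flat.comp h1 (RingHom.Flat.of_bijective (toPush (p := p) (e := e) (R := R)).bijective)
  exact h2

/-! ## `R`-linear maps `F^e_* R → R` (`p^{-e}`-linear maps) -/

/-- An `R`-linear `ψ : F^e_* R → R` is `p^{-e}`-linear: `ψ(a^(p^e) b) = a ψ(b)`. [folklore] -/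
theorem apply_toPush_pow_mul (ψ : FrobeniusPushforward p e R →ₗ[R] R) (a b : R) :
    ψ (toPush (a ^ p ^ e * b)) = a * ψ (toPush b) := by
  rw [← smul_toPush, map_smul, smul_eq_mul]

/-- **An `R`-linear `ψ : F^e_* R → R` maps `J^[p^e]` into `J`**: `ψ(∑ rᵢ zᵢ^q) = ∑ zᵢ ψ(rᵢ)`.
[cite: Huneke1998, proof of Thm. 3.2 (applying `φ` to `u^{1/p} ∈ I R^{1/p}`)] -/
theorem apply_toPush_mem_of_mem_frobeniusPower (ψ : FrobeniusPushforward p e R →ₗ[R] R)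
    {J : Ideal R} {y : R} (hy : y ∈ frobeniusPower (p ^ e) J) : ψ (toPush y) ∈ J := by
  -- induct over the span with the multiplicatively stable predicate `∀ r, ψ(r y) ∈ J`
  suffices h : ∀ r : R, ψ (toPush (r * y)) ∈ J by simpa using h 1
  rw [frobeniusPower_def] at hy
  refine Submodule.span_induction (p := fun y _ => ∀ r : R, ψ (toPush (r * y)) ∈ J)
    ?_ ?_ ?_ ?_ hy
  · rintro _ ⟨z, hz, rfl⟩ r
    rw [mul_comm, apply_toPush_pow_mul]
    exact J.mul_mem_right _ hz
  · intro r
    rw [mul_zero, map_zero, map_zero]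
    exact J.zero_mem
  · intro a b _ _ ha hb r
    rw [mul_add, map_add, map_add]
    exact J.add_mem (ha r) (hb r)
  · intro s a _ ha r
    rw [smul_eq_mul, ← mul_assoc]
    exact ha (r * s)

/-! ## Functoriality in the ring -/

/-- **Functoriality**: an `R`-algebra `S` (both of exponential characteristic `p`) gives an
`R`-linear map `F^e_* R → F^e_* S`, the algebra map on underlying elements
(`r^(p^e) x ↦ (algebraMap r)^(p^e) · algebraMap x`). Used with `S = R_P` to compare `F^e_* R`
with `F^e_*` of a localisation. [folklore] -/
def pushAlgebraMap (S : Type v) [CommRing S] [Algebra R S] [ExpChar S p] :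
    FrobeniusPushforward p e R →ₗ[R] FrobeniusPushforward p e S where
  toFun x := toPush (algebraMap R S ((toPush (p := p) (e := e) (R := R)).symm x))
  map_add' x y := by
    rw [map_add, map_add, map_add]
  map_smul' r x := by
    obtain ⟨x, rfl⟩ := (toPush (p := p) (e := e) (R := R)).surjective x
    rw [RingHom.id_apply, smul_toPush, RingEquiv.symm_apply_apply, RingEquiv.symm_apply_apply,
      map_mul, map_pow, smul_def, map_mul, map_pow]

/-- `pushAlgebraMap` on elements. [folklore] -/
theorem pushAlgebraMap_toPush (S : Type v) [CommRing S] [Algebra R S] [ExpChar S p] (x : R) :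
    pushAlgebraMap (p := p) (e := e) S (toPush x) = toPush (algebraMap R S x) := rfl

/-! ## Image ideals -/

/-- The **image ideal** of `d` at level `e`: `A_e(d) = {ψ(d) : ψ ∈ Hom_R(F^e_* R, R)}`, the
values at `d` of all `p^{-e}`-linear maps. [cite: HochsterHuneke1989, §3; folklore] -/
def imageIdeal (p e : ℕ) [ExpChar R p] (d : R) : Ideal R :=
  LinearMap.range
    (LinearMap.applyₗ (toPush d : FrobeniusPushforward p e R) :
      (FrobeniusPushforward p e R →ₗ[R] R) →ₗ[R] R)

/-- Membership in the image ideal. [folklore] -/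
theorem mem_imageIdeal_iff {e : ℕ} {d a : R} :
    a ∈ imageIdeal p e d ↔ ∃ ψ : FrobeniusPushforward p e R →ₗ[R] R, ψ (toPush d) = a := by
  simp only [imageIdeal, LinearMap.mem_range, LinearMap.applyₗ_apply_apply]

/-- The value of any `p^{-e}`-linear map at `d` lies in `A_e(d)`. [folklore] -/
theorem apply_mem_imageIdeal {e : ℕ} (ψ : FrobeniusPushforward p e R →ₗ[R] R) (d : R) :
    ψ (toPush d) ∈ imageIdeal p e d :=
  mem_imageIdeal_iff.mpr ⟨ψ, rfl⟩

/-! ## Composition of levels -/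

/-- **Composition of levels**: from `ψ : F^e_* R → R` and `φ : F_* R → R` (both `R`-linear), the
map `x ↦ ψ(φ(x))` is `R`-linear on `F^{e+1}_* R`
(`φ(r^{p^{e+1}} x) = r^{p^e} φ(x)`, then `ψ(r^{p^e} y) = r ψ(y)`). [cite: HochsterHuneke1989, §3;
folklore] -/
def compLevelOne {e : ℕ} (ψ : FrobeniusPushforward p e R →ₗ[R] R)
    (φ : FrobeniusPushforward p 1 R →ₗ[R] R) : FrobeniusPushforward p (e + 1) R →ₗ[R] R where
  toFun x := ψ (toPush (φ (toPush ((toPush (p := p) (e := e + 1) (R := R)).symm x))))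
  map_add' x y := by
    rw [map_add, map_add, map_add, map_add, map_add]
  map_smul' r x := by
    obtain ⟨x, rfl⟩ := (toPush (p := p) (e := e + 1) (R := R)).surjective x
    rw [RingHom.id_apply, smul_toPush, RingEquiv.symm_apply_apply, RingEquiv.symm_apply_apply,
      smul_eq_mul]
    have h1 : r ^ p ^ (e + 1) * x = (r ^ p ^ e) ^ p ^ 1 * x := by
      rw [pow_one, ← pow_mul, ← pow_succ]
    rw [h1, apply_toPush_pow_mul, apply_toPush_pow_mul]

/-- `compLevelOne` on elements. [folklore] -/
theorem compLevelOne_toPush {e : ℕ} (ψ : FrobeniusPushforward p e R →ₗ[R] R)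
    (φ : FrobeniusPushforward p 1 R →ₗ[R] R) (x : R) :
    compLevelOne ψ φ (toPush x) = ψ (toPush (φ (toPush x))) := rfl

end FrobeniusPushforward

end Literature.RingTheory.TightClosure

end
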